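import Mathlib
import HarnessLib
import Summits.Parity.Statement
import Summits.Parity.GeneralizedHardyLittlewood.Theses.ParityLineCarving

/-!
# Assembly of route-Parity-ParityLineCarving (item stmt-Parity-27820)

`Assembly : BoundedSiegelZeroQuality → UpperParityLine → UpperParityLiftQ → LowerDilutedChen → LowerDilutionLiftQ → GeneralizedHardyLittlewood` is literally the route's certified deciding theorem `closes`
(node G1.4 «ParityLineCarving» (decomp-parity lens-6 g3; rev 2)): the two parity-accessible envelopes and their Q-conditioned lifts give the two halves, `abs_sub_le_iff`.  One line; no mathematics beyond the route file.
-/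

namespace Summit.Parity.GeneralizedHardyLittlewood.Theses.ParityLineCarving

/-- Assembly item stmt-Parity-27820 of route-Parity-ParityLineCarving:
`BoundedSiegelZeroQuality → UpperParityLine → UpperParityLiftQ → LowerDilutedChen → LowerDilutionLiftQ → GeneralizedHardyLittlewood`,
by the route's deciding theorem `closes`. -/
theorem assembly_proof : Assembly :=
  fun h1 h2 h3 h4 h5 => closes h1 h2 h3 h4 h5

end Summit.Parity.GeneralizedHardyLittlewood.Theses.ParityLineCarving
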